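import Summits.QuantumFields.YangMills.Theorems.BalabanUVNodesN18HLayerW1ConfigRecord

/-!
# BalabanUVNodes ∕ N18 — (1.17)–(1.18) AND [I] p. 263's ANALYTICITY AT THE TABLE OF RECORD FROM THE H-LAYER DATUM ON ITS ρ-THICKENING: the
# ambient form of [II] p. 15's «constants α′₀, α′₁ much bigger than α₀, α₁» — W1's named pair (`AnalyticH`, `Bound238`) on the OPEN table
# `X ↦ Metric.thickening ρ (sp X)` ⟹ file 9 on that table ⟹ `W1.TermAnalytic` ∕ `W1.TermBound118` on it AND on `sp` itself, and n22-c's (1.17) face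
# with its margin `ball φ ρ ⊆ thickening ρ (sp X)` DISCHARGED ⟹ `W1.TermDerivBound S W sp (E₀∕ρ) r₁` AT THE TABLE OF RECORD (uniform constant)
# (Track A, DAG node N18 = NE5 `T4OutputRate.NE5 EA EB W κ θ C₅` :211; cluster K4 «SpineRates»; file 13 of seat pub-ymgap-dag-n18-c, row s1, generation 3;
# repairs the item LOCATED in files 10∕11: «`ball φ ρ ⊆ spaceOfRecord` is unsatisfiable — the (1.17) Cauchy step wants an open neighbourhood table»)

Cell `pub-ymgap`, HUMAN RULING D-0062 (Track A), R134 ACCELERATION seat `pub-ymgap-dag-n18-c` (strategy s1), generation 3.  THEOREMS ONLY (no `def`,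
no `instance`, no `sorry`); imports file 10 (through it file 9 and n22-c's `…N22W1DerivBound`); restates nothing.

WHY.  File 11 proved that the table of record `W1.spaceOfRecord` (SU(N) setting) is not open in `Φ`, so neither file 9's `IsOpen (sp X)` nor the margin
`ball φ ρ ⊆ sp j X` of n22-c's (1.17) face `YMDAG.N22.W1.termDerivBound_of_termBound118` can be fed the table of record; file 10 repaired (1.18) and the
analyticity by a neighbourhood extension whose open set `V` has no uniform inradius, so (1.17) with a UNIFORM constant stayed located.  Print's (1.17)
([I] p. 263: «the configurations satisfying (i)–(iii) with smaller constants α′₀, α′₁ lie in U^c_j(X, α₀, α₁)» + Cauchy) rests on analyticity AND the bound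
on a BIGGER space containing a uniform margin around the smaller one; [II] p. 15 likewise puts the analyticity of the forms and covariances on spaces «with
constants α′₀, α′₁ much bigger».  In W1's AMBIENT reading (`AnalyticOnNhd` in `Φ`) the faithful form of «bigger space with a uniform margin» is the open
ρ-THICKENING `Metric.thickening ρ (sp X) = {φ | infDist φ (sp X) < ρ}` of the table: it is OPEN, contains `ball φ ρ` for every `φ ∈ sp X`, and inherits
the restriction property.  So: W1's named pair ASKED ON THE THICKENED TABLE (the H-layer datum with a margin — a hypothesis of the same kind, N10 ∕ NODE A
content, displayed) gives everything at once: file 9 applies verbatim on the thickened (open) table, monotonicity brings (1.18) and analyticity down to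
`sp`, and n22-c's face gets its margin for free — (1.17) AT THE TABLE OF RECORD with the uniform constant `E₀∕ρ`.

WHAT (theorems only; any torus `P` for the table algebra, `F.P K` with the located numerals for the estimates).
* §1 table algebra: `spRestr_thickening` (restriction property passes to the thickened table), `self_subset_thickening_table`, `ball_subset_thickening_table`,
  `termAnalytic_mono_table` ∕ `termBound118_mono_table` (both predicates are antitone in the table).
* §2 (LEVEL-DEPENDENT radii `ρ j`, as (1.22) [I] ∕ (2.28) [III]) `termAnalytic_thickening_of_bound238` ∕ `termBound118_thickening_of_bound238` — file 9's
  tower theorems ON THE THICKENED TABLE `j X ↦ thickening (ρ j) (sp j X)` (open by `Metric.isOpen_thickening`) from W1's named pair on it;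
  `termAnalytic_of_bound238_thickening` ∕ `termBound118_of_bound238_thickening` — the same ON `sp` (`ρ j > 0`).
* §3 `derivBoundOn_of_bound238_thickening` — **(1.17) AT THE TABLE ITSELF, LEVEL BY LEVEL**: `W1.DerivBoundOn (termC S j X g) (sp j X)
  ((E₀∕ρ_j)·e^{−r₁ d_j(X)})` (n22-c's per-term Cauchy face `derivBoundOn_termC_of_ball`, margin by `Metric.ball_subset_thickening`);
  `termDerivBound_of_bound238_thickening` — for a level-uniform radius, `W1.TermDerivBound S W sp (E₀∕ρ) r₁` (n22-c's `termDerivBound_of_termBound118`).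

HONEST FRAMING — what this is NOT.  Count-neutral kernel bookkeeping; NOT a discharge of N18 (typed 28∕28 · discharged 5∕27 UNCHANGED).  The H-layer pair on the
THICKENED table is a DISPLAYED hypothesis (N10's Lemmas 1–3 ∕ NODE A content read with a margin, as print reads it on the bigger-constant spaces; whether
Bałaban's (2.38) survives a Φ-thickening of `U^c_{k+1}(X, α₀, α₁)` of some radius ρ is exactly the «α′ much bigger» clause, asserted nowhere here; the
pair is satisfiable on ANY table by file 9's junk riders `analyticH_termlessTower` ∕ `bound238_termlessTower`); `ρ > 0`, `SpRestr`, the numerals displayed.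
ONE radius `ρ` for all levels: print's margins are the level-dependent radii `α_{·,j}(g_j)` ((1.22) [I] ∕ (2.28) [III]), so a level-uniform `ρ` is a
lower bound of the margins ALONG THE RUN (positive for a finite run; its K-uniformity is the consumer's question, not settled here).  NE5 untouched; NOT IN PRINT, NOT PROVED.  One finite four-torus programme at fixed `ε`, Bałaban as printed — NOT the
continuum limit on ℝ⁴, NOT infinite volume, NOT OS, NOT a mass gap, NOT Clay.  0 `sorry`, 0 `def`; axioms standard.

References (TYPES ∕ loci only): [I] = [Balaban1987RG1] CMP **109** (1987) — (1.17)–(1.18) and the sentence before (1.18), p. 263; [II] = [Balaban1988RG2Cluster]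
CMP **116** (1988) — p. 15 (analyticity on the bigger-constant spaces), Lemma 3 (2.38) p. 20, (2.39)–(2.41) p. 21.
-/

noncomputable section

namespace Summit.QuantumFields.YangMills.BalabanUVNodes.N18HLayerW1Thickened

open Set Metric
open scoped BigOperators
open Literature.MathematicalPhysics.QuantumFieldTheory.Balaban1983to89
open Literature.MathematicalPhysics.QuantumFieldTheory.Balaban1983to89.T4Continuum (T4Family)
open Literature.MathematicalPhysics.QuantumFieldTheory.Balaban1983to89.T4OutputRate
open Literature.MathematicalPhysics.QuantumFieldTheory.Balaban1983to89.TreeLengthTorus (TPt TDom tsys torusTreeLen)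
open Literature.MathematicalPhysics.QuantumFieldTheory.Balaban1983to89.B12TreeDecay (K₀)
open Literature.MathematicalPhysics.QuantumFieldTheory.Balaban1983to89.Node00
open Literature.MathematicalPhysics.QuantumFieldTheory.Balaban1983to89.Node00.Sect2 (domSys domCount CPair)
open Literature.MathematicalPhysics.QuantumFieldTheory.Balaban1983to89.Node00.W1
open YMDAG.N22.W1 (termDerivBound_of_termBound118 derivBoundOn_termC_of_ball)
open Summit.QuantumFields.YangMills.BalabanUVNodes.N18HLayerW1Config (termAnalytic_of_bound238_four termBound118_of_bound238_four)

/-! ## §1 Table algebra: the thickened table, monotonicity of the tower predicates -/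

section Tables

variable {P : Params} {𝔸 : Type*} [NormedRing 𝔸] [NormedAlgebra ℂ 𝔸] {M : ℕ}

omit [NormedAlgebra ℂ 𝔸] in
/-- The restriction property ([II] p. 15) passes to the ρ-thickened table: `Z ⊆ X ⇒ sp X ⊆ sp Z ⇒ thickening ρ (sp X) ⊆ thickening ρ (sp Z)`. [folklore] -/
theorem spRestr_thickening {j : ℕ} {sp : (domSys P M j).Dom → Set (CPair P 𝔸)} (h : W1.SpRestr sp) (ρ : ℝ) :
    W1.SpRestr fun X => thickening ρ (sp X) :=
  fun X Z hZ => thickening_subset_of_subset ρ (h X Z hZ)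

omit [NormedAlgebra ℂ 𝔸] in
/-- The table lies in its ρ-thickening (`ρ > 0`). [folklore] -/
theorem self_subset_thickening_table {j : ℕ} (sp : (domSys P M j).Dom → Set (CPair P 𝔸)) {ρ : ℝ} (hρ : 0 < ρ)
    (X : (domSys P M j).Dom) : sp X ⊆ thickening ρ (sp X) :=
  self_subset_thickening hρ _

omit [NormedAlgebra ℂ 𝔸] in
/-- The ρ-thickening holds the ρ-ball about every point of the table — the MARGIN of [I] p. 263. [folklore] -/
theorem ball_subset_thickening_table {j : ℕ} (sp : (domSys P M j).Dom → Set (CPair P 𝔸)) (ρ : ℝ) (X : (domSys P M j).Dom)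
    {φ : CPair P 𝔸} (hφ : φ ∈ sp X) : ball φ ρ ⊆ thickening ρ (sp X) :=
  ball_subset_thickening hφ ρ

/-- `W1.TermAnalytic` is antitone in the table. [folklore] -/
theorem termAnalytic_mono_table (S : ClusterTower P 𝔸 M) (W : Set (ℕ → ℝ)) {sp sp' : (j : ℕ) → (domSys P M j).Dom → Set (CPair P 𝔸)}
    (hle : ∀ j X, sp' j X ⊆ sp j X) (h : TermAnalytic S W sp) : TermAnalytic S W sp' :=
  fun g hg j X => (h g hg j X).mono (hle j X)

omit [NormedRing 𝔸] [NormedAlgebra ℂ 𝔸] in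
/-- `W1.TermBound118` is antitone in the table. [folklore] -/
theorem termBound118_mono_table (S : ClusterTower P 𝔸 M) (W : Set (ℕ → ℝ)) {sp sp' : (j : ℕ) → (domSys P M j).Dom → Set (CPair P 𝔸)}
    {E₀ r : ℝ} (hle : ∀ j X, sp' j X ⊆ sp j X) (h : TermBound118 S W sp E₀ r) : TermBound118 S W sp' E₀ r :=
  fun g hg j X φ hφ => h g hg j X φ (hle j X hφ)

end Tables

/-! ## §2 File 9 on the thickened (open) table — LEVEL-DEPENDENT radii `ρ j` ((1.22) [I] ∕ (2.28) [III]) — and down to the table itself -/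

section Thickened

variable (F : T4Family) (K : ℕ) {𝔸 : Type*} [NormedRing 𝔸] [NormedAlgebra ℂ 𝔸] {M : ℕ}

open Classical in
/-- **[I] p. 263 ANALYTICITY ON THE THICKENED TABLE** from W1's named pair ON THE THICKENED TABLE `X ↦ thickening (ρ (k+1)) (sp (k+1) X)` (`han`, `h238`:
the H-layer datum with a margin `ρ j` at level `j` — [II] p. 15's bigger-constant spaces in the ambient reading, radii level-dependent as in (1.22) ∕ (2.28);
DISPLAYED), the restriction property of `sp`, the located clauses: file 9's `termAnalytic_of_bound238_four` on that OPEN table. [folklore] -/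
theorem termAnalytic_thickening_of_bound238 (S : ClusterTower (F.P K) 𝔸 M) (W : Set (ℕ → ℝ)) (Wk : (k : ℕ) → Set (Fin (k + 1) → ℝ))
    (sp : (j : ℕ) → (domSys (F.P K) M j).Dom → Set (CPair (F.P K) 𝔸)) (ρ : ℕ → ℝ) {A R r₁ : ℝ} (hW : ∀ k, ∀ g ∈ W, restrictPrefix k g ∈ Wk k)
    (hrestr : ∀ k, W1.SpRestr (sp (k + 1))) (han : ∀ k, (S k).AnalyticH (Wk k) fun X => thickening (ρ (k + 1)) (sp (k + 1) X))
    (h238 : ∀ k, (S k).Bound238 (Wk k) (fun X => thickening (ρ (k + 1)) (sp (k + 1) X)) A R) (hA : 0 ≤ A) (hr₁ : 0 ≤ r₁)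
    (hrate : r₁ + 2 * (64 * Real.log 162) + 2 ≤ R) (hsmall : A * Real.exp (5 * r₁ + 1) * K₀ 64 8 * 9 * 64 ≤ 1) :
    TermAnalytic S W fun j X => thickening (ρ j) (sp j X) :=
  termAnalytic_of_bound238_four F K S W Wk (fun j X => thickening (ρ j) (sp j X)) hW (fun _ _ => isOpen_thickening)
    (fun k => spRestr_thickening (hrestr k) (ρ (k + 1))) han h238 hA hr₁ hrate hsmall

open Classical in
/-- **(1.18) ON THE THICKENED TABLE** likewise: `W1.TermBound118 S W (j X ↦ thickening (ρ j) (sp j X)) (e·9·64·K₀(64,8)²·A) r₁`. [folklore] -/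
theorem termBound118_thickening_of_bound238 (S : ClusterTower (F.P K) 𝔸 M) (W : Set (ℕ → ℝ)) (Wk : (k : ℕ) → Set (Fin (k + 1) → ℝ))
    (sp : (j : ℕ) → (domSys (F.P K) M j).Dom → Set (CPair (F.P K) 𝔸)) (ρ : ℕ → ℝ) {A R r₁ : ℝ} (hW : ∀ k, ∀ g ∈ W, restrictPrefix k g ∈ Wk k)
    (hrestr : ∀ k, W1.SpRestr (sp (k + 1))) (han : ∀ k, (S k).AnalyticH (Wk k) fun X => thickening (ρ (k + 1)) (sp (k + 1) X))
    (h238 : ∀ k, (S k).Bound238 (Wk k) (fun X => thickening (ρ (k + 1)) (sp (k + 1) X)) A R) (hA : 0 ≤ A) (hr₁ : 0 ≤ r₁)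
    (hrate : r₁ + 2 * (64 * Real.log 162) + 2 ≤ R) (hsmall : A * Real.exp (5 * r₁ + 1) * K₀ 64 8 * 9 * 64 ≤ 1) :
    TermBound118 S W (fun j X => thickening (ρ j) (sp j X)) (Real.exp 1 * 9 * 64 * K₀ 64 8 ^ 2 * A) r₁ :=
  termBound118_of_bound238_four F K S W Wk (fun j X => thickening (ρ j) (sp j X)) hW (fun _ _ => isOpen_thickening)
    (fun k => spRestr_thickening (hrestr k) (ρ (k + 1))) han h238 hA hr₁ hrate hsmall

open Classical in
/-- **[I] p. 263 ANALYTICITY ON THE TABLE ITSELF** (e.g. the table of record) from the datum on its thickening, radii `ρ j > 0` (monotonicity). [folklore] -/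
theorem termAnalytic_of_bound238_thickening (S : ClusterTower (F.P K) 𝔸 M) (W : Set (ℕ → ℝ)) (Wk : (k : ℕ) → Set (Fin (k + 1) → ℝ))
    (sp : (j : ℕ) → (domSys (F.P K) M j).Dom → Set (CPair (F.P K) 𝔸)) {ρ : ℕ → ℝ} (hρ : ∀ j, 0 < ρ j) {A R r₁ : ℝ}
    (hW : ∀ k, ∀ g ∈ W, restrictPrefix k g ∈ Wk k) (hrestr : ∀ k, W1.SpRestr (sp (k + 1)))
    (han : ∀ k, (S k).AnalyticH (Wk k) fun X => thickening (ρ (k + 1)) (sp (k + 1) X))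
    (h238 : ∀ k, (S k).Bound238 (Wk k) (fun X => thickening (ρ (k + 1)) (sp (k + 1) X)) A R) (hA : 0 ≤ A) (hr₁ : 0 ≤ r₁)
    (hrate : r₁ + 2 * (64 * Real.log 162) + 2 ≤ R) (hsmall : A * Real.exp (5 * r₁ + 1) * K₀ 64 8 * 9 * 64 ≤ 1) :
    TermAnalytic S W sp :=
  termAnalytic_mono_table S W (fun j X => self_subset_thickening_table (sp j) (hρ j) X)
    (termAnalytic_thickening_of_bound238 F K S W Wk sp ρ hW hrestr han h238 hA hr₁ hrate hsmall)

open Classical in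
/-- **(1.18) ON THE TABLE ITSELF** from the datum on its thickening: `W1.TermBound118 S W sp (e·9·64·K₀(64,8)²·A) r₁`. [folklore] -/
theorem termBound118_of_bound238_thickening (S : ClusterTower (F.P K) 𝔸 M) (W : Set (ℕ → ℝ)) (Wk : (k : ℕ) → Set (Fin (k + 1) → ℝ))
    (sp : (j : ℕ) → (domSys (F.P K) M j).Dom → Set (CPair (F.P K) 𝔸)) {ρ : ℕ → ℝ} (hρ : ∀ j, 0 < ρ j) {A R r₁ : ℝ}
    (hW : ∀ k, ∀ g ∈ W, restrictPrefix k g ∈ Wk k) (hrestr : ∀ k, W1.SpRestr (sp (k + 1)))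
    (han : ∀ k, (S k).AnalyticH (Wk k) fun X => thickening (ρ (k + 1)) (sp (k + 1) X))
    (h238 : ∀ k, (S k).Bound238 (Wk k) (fun X => thickening (ρ (k + 1)) (sp (k + 1) X)) A R) (hA : 0 ≤ A) (hr₁ : 0 ≤ r₁)
    (hrate : r₁ + 2 * (64 * Real.log 162) + 2 ≤ R) (hsmall : A * Real.exp (5 * r₁ + 1) * K₀ 64 8 * 9 * 64 ≤ 1) :
    TermBound118 S W sp (Real.exp 1 * 9 * 64 * K₀ 64 8 ^ 2 * A) r₁ :=
  termBound118_mono_table S W (fun j X => self_subset_thickening_table (sp j) (hρ j) X)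
    (termBound118_thickening_of_bound238 F K S W Wk sp ρ hW hrestr han h238 hA hr₁ hrate hsmall)

/-! ## §3 (1.17) AT THE TABLE ITSELF: per level with the constant `E₀∕ρ_j`, and `W1.TermDerivBound` for a level-uniform radius -/

open Classical in
/-- **(1.17) AT THE TABLE ITSELF, LEVEL BY LEVEL** ([I] p. 263): for every history of `W`, level `j` and domain `X`, `E^{(j)}(X; g; ·)` is differentiable
at every point of `sp j X` with `‖∂_{(𝐔,𝐉)} E^{(j)}(X; g; ·)‖ ≤ (E₀∕ρ_j)·e^{−r₁ d_j(X)}` (`W1.DerivBoundOn`), from the H-layer datum on the `ρ_j`-thickened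
table — n22-c's per-term Cauchy face `YMDAG.N22.W1.derivBoundOn_termC_of_ball` with its margin `ball φ (ρ j) ⊆ thickening (ρ j) (sp j X)` DISCHARGED
(`Metric.ball_subset_thickening`) and its two analytic inputs produced on the thickened table by §2; `E₀ = e·9·64·K₀(64,8)²·A`. [folklore] -/
theorem derivBoundOn_of_bound238_thickening (S : ClusterTower (F.P K) 𝔸 M) (W : Set (ℕ → ℝ)) (Wk : (k : ℕ) → Set (Fin (k + 1) → ℝ))
    (sp : (j : ℕ) → (domSys (F.P K) M j).Dom → Set (CPair (F.P K) 𝔸)) {ρ : ℕ → ℝ} (hρ : ∀ j, 0 < ρ j) {A R r₁ : ℝ}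
    (hW : ∀ k, ∀ g ∈ W, restrictPrefix k g ∈ Wk k) (hrestr : ∀ k, W1.SpRestr (sp (k + 1)))
    (han : ∀ k, (S k).AnalyticH (Wk k) fun X => thickening (ρ (k + 1)) (sp (k + 1) X))
    (h238 : ∀ k, (S k).Bound238 (Wk k) (fun X => thickening (ρ (k + 1)) (sp (k + 1) X)) A R) (hA : 0 ≤ A) (hr₁ : 0 ≤ r₁)
    (hrate : r₁ + 2 * (64 * Real.log 162) + 2 ≤ R) (hsmall : A * Real.exp (5 * r₁ + 1) * K₀ 64 8 * 9 * 64 ≤ 1) :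
    ∀ g ∈ W, ∀ (j : ℕ) (X : (domSys (F.P K) M j).Dom),
      DerivBoundOn (termC S j X g) (sp j X) (Real.exp 1 * 9 * 64 * K₀ 64 8 ^ 2 * A / ρ j * Real.exp (-(r₁ * (domSys (F.P K) M j).dj X))) :=
  fun g hg j X =>
    derivBoundOn_termC_of_ball S X g (hρ j) (fun _ hφ => ball_subset_thickening_table (sp j) (ρ j) X hφ)
      (termAnalytic_thickening_of_bound238 F K S W Wk sp ρ hW hrestr han h238 hA hr₁ hrate hsmall g hg j X)
      (fun ψ hψ => termBound118_thickening_of_bound238 F K S W Wk sp ρ hW hrestr han h238 hA hr₁ hrate hsmall g hg j X ψ hψ)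

open Classical in
/-- **(1.17) AT THE TABLE ITSELF — e.g. AT THE TABLE OF RECORD `W1.spaceOfRecord` — WITH A LEVEL-UNIFORM RADIUS `ρ`**: `W1.TermDerivBound S W sp
(e·9·64·K₀(64,8)²·A ∕ ρ) r₁` (n22-c's `termDerivBound_of_termBound118` at `sp := thickened table`, `sp′ := sp`, margin by `Metric.ball_subset_thickening`).
This repairs, in the ambient reading, the item located in files 10∕11 (no ball fits inside the table of record; it fits inside its thickening). [folklore] -/
theorem termDerivBound_of_bound238_thickening (S : ClusterTower (F.P K) 𝔸 M) (W : Set (ℕ → ℝ)) (Wk : (k : ℕ) → Set (Fin (k + 1) → ℝ))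
    (sp : (j : ℕ) → (domSys (F.P K) M j).Dom → Set (CPair (F.P K) 𝔸)) {ρ A R r₁ : ℝ} (hρ : 0 < ρ) (hW : ∀ k, ∀ g ∈ W, restrictPrefix k g ∈ Wk k)
    (hrestr : ∀ k, W1.SpRestr (sp (k + 1))) (han : ∀ k, (S k).AnalyticH (Wk k) fun X => thickening ρ (sp (k + 1) X))
    (h238 : ∀ k, (S k).Bound238 (Wk k) (fun X => thickening ρ (sp (k + 1) X)) A R) (hA : 0 ≤ A) (hr₁ : 0 ≤ r₁)
    (hrate : r₁ + 2 * (64 * Real.log 162) + 2 ≤ R) (hsmall : A * Real.exp (5 * r₁ + 1) * K₀ 64 8 * 9 * 64 ≤ 1) :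
    TermDerivBound S W sp (Real.exp 1 * 9 * 64 * K₀ 64 8 ^ 2 * A / ρ) r₁ :=
  termDerivBound_of_termBound118 S W (fun j X => thickening ρ (sp j X)) sp hρ
    (fun j X _ hφ => ball_subset_thickening_table (sp j) ρ X hφ)
    (termAnalytic_thickening_of_bound238 F K S W Wk sp (fun _ => ρ) hW hrestr han h238 hA hr₁ hrate hsmall)
    (termBound118_thickening_of_bound238 F K S W Wk sp (fun _ => ρ) hW hrestr han h238 hA hr₁ hrate hsmall)

end Thickened

end Summit.QuantumFields.YangMills.BalabanUVNodes.N18HLayerW1Thickened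

end
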